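import Summits.BirchSwinnertonDyer.BirchSwinnertonDyer.Theorems.SylvesterTwoHeegnerIndexCMHalfBottomOfFixing
import Summits.BirchSwinnertonDyer.BirchSwinnertonDyer.Theorems.SylvesterTwoHeegnerIndexCMFlipCoherentFrame
import Summits.BirchSwinnertonDyer.BirchSwinnertonDyer.Theorems.SylvesterTwoHeegnerIndexCMDataCoupledFrame
import Summits.BirchSwinnertonDyer.BirchSwinnertonDyer.Theorems.SylvesterTwoHeegnerIndexCMDataRationality
import Summits.BirchSwinnertonDyer.BirchSwinnertonDyer.Theorems.SylvesterTwoHeegnerIndexThmCOfTwoIntegral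
import Summits.BirchSwinnertonDyer.BirchSwinnertonDyer.Theorems.SylvesterTwoHeegnerIndexThmCOfCMPointCore
import Literature.NumberTheory.EllipticCurves.RingClassFieldCubeRoots
import HarnessLib

/-!
# (T) of crux `UpperOffV0HSYPlus` (stmt-BirchSwinnertonDyer-19804), skeleton VARIANT M: `stub_thmC` —
# THEOREM C (item 19802) MODULO {`Dt` of degree 6, #19} AND THE TOWER FIXING AT `n = 1`

Planner D525 (3)(a) / D528 (3) / D531 (2) (g25's sequel #T handed to this seat, no veto in advance; planner
byte-check vs `stub_thmC`, skeleton `Lines/coupled_variantM.lean` 406ca288e244d392 l.187–204).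

THE ARGUMENT.  THEOREM C (★) (`SylvesterTwoNonneg.HSYPointTwoDivisibleSevenModNine` = the route decl
`Theses.SylvesterTwoHeegnerIndex.HSYPointTwoDivisibleSevenModNine`, `Iff.rfl`) is, modulo Hu–Shu–Yin's printed
display, the `2`-INTEGRALITY `0 ≤ ord₂(#Ш_an(E_p)·#Ш_an(E_{3p²}))` on `p ≡ 7 (9)` (two's
`hsyPointTwoDivisibleSevenModNine_iff_pairProductTwoIntegral_of_heightDisplay`, p-file `…ThmCOfTwoIntegral`).
The integrality is read off ONE point: by #S1′ (`exists_halfPoint_of_named_of_fixing`, this seat) the tower fixing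
at `n = 1` (an involution `s` of `K[9p]/K` fixing `∛3, ∛p` and HSY's CM point `y₁`) and #19 give, at every pair of
minimal models, a `ℚ`-generator `P` and a point `Y′ ∈ B(K)` with `(qB·qA)·ĥ(ιP) = 2⁰·ĥ(Y′)`; two's
`le_padicValRat_two_of_model` (the `2`-primitive descent on the `ℤ[ω]`-lattice `B(K)/tors`, `rank_ℤ B(K) = 2`
from #19) turns exponent `0` into `0 ≤ ord₂(qB·qA)`.  The frame (`ι`, coherent `emb`, pinned `κ`, the cubic
twist `ψ_B`, `∛3, ∛p ∈ K[9p]`, the stabiliser `H`, `y₁`) is instantiated exactly as in #S9c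
`layerL1Seven_of_named_of_flip_of_fixing`; `K = ℚ(ζ₃)` by x1b's `exists_quadraticField_omega`.

* `pairProductTwoIntegralSevenModNine_of_named_of_fixing (Dt) (hdeg) (hD : #19) (hTF₁)` :
  `SylvesterTwoNonneg.PairProductTwoIntegralSevenModNine`;
* **`thmC_of_named_of_fixing (Dt) (hdeg) (hD) (hTF₁) : PublishedFactsTwoPlus → HSYPointTwoDivisibleSevenModNine`**
  — `stub_thmC`'s type VERBATIM behind the three displayed binders (the display conjunct of `PublishedFactsTwoPlus`
  feeds two's `hsyPointTwoDivisibleSevenModNine_of_heightDisplay_of_twoIntegral`);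
* `theses_hsyPointTwoDivisibleSevenModNine_of_named_of_fixing` — the same with the ROUTE DECL of item 19802 as the
  conclusion and the unnamed display as a fourth binder.

`hTF₁` = the `n = 1` clause of #S9c's displayed `hTF` VERBATIM (same binders, conclusion cut after `s·y₁ = y₁`), so
`hTF → hTF₁` is a projection.  HONEST LABEL: CONDITIONAL closures; the tower fixing is the cell lemma W2-b at
`n = 1` (memo two §15.5 (C-b) «`σ_{−1}` fixes `P₀`» / §67.2; Shimura reciprocity on `X₀(243)`; NOT print, NOT in
the tree, desk (M-K3-7) pending); items 19802 / 19804 stay OPEN on the ledger; no stub closed; X12.CMAtTwo NOT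
proved; BSD is not proved by any of this, for any curve.  `--supports stmt-BirchSwinnertonDyer-19804 --as helper`.
-/

set_option linter.dupNamespace false
set_option autoImplicit false

noncomputable section

open scoped Classical Pointwise

namespace Summit.BirchSwinnertonDyer.BirchSwinnertonDyer.Theorems.SylvesterTwoCMHalf

open WeierstrassCurve WeierstrassCurve.Affine.Point Field NumberField IsDedekindDomain Finset
open Literature.NumberTheory.EllipticCurves Literature.NumberTheory.GaloisRepresentations
  Literature.NumberTheory.EllipticCurves.ModularForms
  Literature.NumberTheory.EllipticCurves.HuShuYin2019
  Literature.NumberTheory.EllipticCurves.KolyvaginCocycle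
  Literature.NumberTheory.EllipticCurves.RingClassField
  Summit.BirchSwinnertonDyer.BirchSwinnertonDyer.Theses.SylvesterTwoHeegnerIndex
  Summit.BirchSwinnertonDyer.BirchSwinnertonDyer.Theorems
  Summit.BirchSwinnertonDyer.BirchSwinnertonDyer.Theorems.SylvesterTwoCMData
  Summit.BirchSwinnertonDyer.BirchSwinnertonDyer.Theorems.SylvesterTwoCMFlip
  Summit.BirchSwinnertonDyer.Rank1Residual.X11b Summit.BirchSwinnertonDyer.Rank1Residual.X11b.RingClassTower

set_option maxHeartbeats 1600000 in
/-- **`0 ≤ ord₂(#Ш_an(E_p)·#Ш_an(E_{3p²}))` on `p ≡ 7 (mod 9)` FROM {`Dt` of degree 6, #19, TOWER FIXING at `n = 1`}.**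
For every prime `p ≡ 7 (9)` with `3 ∉ 𝔽_p^{×3}` and minimal models `B ≅ E_p`, `A ≅ E_{3p²}`: the half point `Y′`
of #S1′ carries the exponent-`0` display `(qB·qA)·ĥ(ιP) = ĥ(Y′)`, and the `2`-primitive descent
(`le_padicValRat_two_of_model`, `i = 0`) gives `0 ≤ ord₂(qB·qA)`.  The tower fixing `hTF₁` is DISPLAYED
(cell lemma, not proved here). [cite: HuShuYin2019, display (bsd) p. 12, Cor. 4.4, §3 p. 8, §2 Prop. 2.4]
[cite: GrossLMS1991, §3–§4] [cite: SilvermanAEC2009, VIII.§1, VIII.9.3] -/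
theorem pairProductTwoIntegralSevenModNine_of_named_of_fixing
    (Dt : ModularParametrizationData (⟨0, 0, 1, 0, -1⟩ : WeierstrassCurve ℚ) 243) (hdeg : Dt.deg = 6)
    (hD : shaAnPair_mul_height_eq_two_zpow_mul_height_named)
    (hTF₁ : ∀ (p : ℕ), p.Prime → p % 9 = 7 → ∀ (K : Type) [Field K] [NumberField K] (ω : K), ω ^ 2 + ω + 1 = 0 →
      Module.finrank ℚ K = 2 → ∀ (ι : K →+* ℂ) (c₃ cp : ringClassField K ι (9 * p)), c₃ ^ 3 = 3 →
      cp ^ 3 = (p : ringClassField K ι (9 * p)) →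
      ∀ (y₁ : ((⟨0, 0, 1, 0, -1⟩ : WeierstrassCurve ℚ).baseChange (ringClassField K ι (9 * p))).toAffine.Point),
        Affine.Point.map (W' := (⟨0, 0, 1, 0, -1⟩ : WeierstrassCurve ℚ)) (ringClassField K ι (9 * p)).subtype.toRatAlgHom y₁ =
          Dt.φ (heegnerTau (81 * ((p : ℤ) ^ 2 + 4 * p + 16), -(9 * (4 * (p : ℤ) ^ 2 + 17 * p + 72)), 4 * (p : ℤ) ^ 2 + 18 * p + 81)) →
      ∃ s : ringClassField K ι (9 * p) ≃ₐ[K] ringClassField K ι (9 * p), s ≠ 1 ∧ s * s = 1 ∧ s c₃ = c₃ ∧ s cp = cp ∧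
        pointGalHom (⟨0, 0, 1, 0, -1⟩ : WeierstrassCurve ℚ) (ringClassField K ι (9 * p)) (s.restrictScalars ℚ) y₁ = y₁) :
    SylvesterTwoNonneg.PairProductTwoIntegralSevenModNine := by
  intro p hp hp7 h3 A B _ _ _ _ hB hA qB qA hqB hqA
  -- ### a quadratic field `K ∋ ω` and the frame of #S9c
  obtain ⟨K, _, _, ω, hω, h2⟩ := SylvesterTwoThmCTwist.exists_quadraticField_omega
  have hp3 : p % 3 = 1 := by omega
  have hp0 : p ≠ 0 := hp.ne_zero
  have hp2 : p ≠ 2 := by rintro rfl; norm_num at hp7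
  have hK := JZero.isImaginaryQuadratic_of_sq_add_self_add_one hω h2
  have hm0 : 9 * p ≠ 0 := mul_ne_zero (by norm_num) hp0
  haveI : Algebra.IsAlgebraic ℚ K := Algebra.IsAlgebraic.of_finite ℚ K
  let ι : K →+* ℂ := (IsAlgClosed.lift : K →ₐ[ℚ] ℂ).toRingHom
  obtain ⟨emb, hembK, -⟩ := exists_coherent_emb (K := K) ι
  haveI := (finiteDimensional_and_isGalois_ringClassField hK ι hm0).1
  haveI := (finiteDimensional_and_isGalois_ringClassField hK ι hm0).2
  obtain ⟨κ, hκG, hκ⟩ := exists_frameTransport_pinned K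
  obtain ⟨vB, vA, ψB, ψA, ρ, hvBc, hvB, -, -, -, hvB3, -, hψB, -, hρ, -, hlawB, -, -⟩ :=
    exists_coupledFrame (K := K) hω hp0
  obtain ⟨r₃, hr₃⟩ := IsAlgClosed.exists_pow_nat_eq (3 : ℂ) (by norm_num : 0 < 3)
  obtain ⟨rp, hrp⟩ := IsAlgClosed.exists_pow_nat_eq (p : ℂ) (by norm_num : 0 < 3)
  have hrp_mem : rp ∈ ringClassField K ι (9 * p) := by
    have h := cubeRoot_mem_ringClassField_nine_mul hω h2 ι hp0 one_ne_zero rp hrp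
    rwa [mul_one] at h
  let c₃ : ringClassField K ι (9 * p) := ⟨r₃, cubeRoot_three_mem_ringClassField hω h2 ι hp0 r₃ hr₃⟩
  let cp : ringClassField K ι (9 * p) := ⟨rp, hrp_mem⟩
  have hc₃ : c₃ ^ 3 = 3 := by apply Subtype.ext; push_cast; exact hr₃
  have hcp : cp ^ 3 = (p : ringClassField K ι (9 * p)) := by apply Subtype.ext; push_cast; exact hrp
  obtain ⟨N₀, hN₀, H, hH, T, hT, -, hfin, -⟩ := exists_bottom_transversal hK ι hp0 (emb (9 * p)) (hembK _) c₃ cp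
  haveI := hfin
  haveI : Fintype H := Fintype.ofFinite _
  let ιe : (letI : DecidableEq (ringClassField K ι (9 * p)) := fun a b ↦ Classical.propDecidable (a = b)
      ((⟨0, 0, 1, 0, -1⟩ : WeierstrassCurve ℚ).baseChange (ringClassField K ι (9 * p))).toAffine.Point →+
        geomPoints ((⟨0, 0, 1, 0, -1⟩ : WeierstrassCurve ℚ).baseChange K)) :=
    letI : DecidableEq (ringClassField K ι (9 * p)) := fun a b ↦ Classical.propDecidable (a = b)
    Affine.Point.map (W' := (⟨0, 0, 1, 0, -1⟩ : WeierstrassCurve ℚ)) (emb (9 * p)).toRatAlgHom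
  have hιe : ∀ P, ιe P = Affine.Point.map (W' := (⟨0, 0, 1, 0, -1⟩ : WeierstrassCurve ℚ)) (emb (9 * p)).toRatAlgHom P :=
    fun _ ↦ rfl
  obtain ⟨y₁, hy₁⟩ := exists_map_eq_phi_sylvesterTau_one_of_sq_add_self_add_one hω h2 ι Dt hp3
  -- ### THE TOWER FIXING at `n = 1` (displayed): the involution `s`, a half `H′` of `H`
  obtain ⟨s, hs1, hs2, hs3, hsp, hsy⟩ := hTF₁ p hp hp7 K ω hω h2 ι c₃ cp hc₃ hcp y₁ hy₁
  set sH : H := ⟨s, (hH s).mpr ⟨hs3, hsp⟩⟩ with hsHdef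
  have hsH2 : sH * sH = 1 := Subtype.ext hs2
  have hsH1 : sH ≠ 1 := fun e ↦ hs1 (congrArg Subtype.val e)
  obtain ⟨H', hH'⟩ := exists_half sH hsH1 hsH2
  have hsy' : pointGalHom (⟨0, 0, 1, 0, -1⟩ : WeierstrassCurve ℚ) (ringClassField K ι (9 * p))
      ((sH : _ ≃ₐ[K] _).restrictScalars ℚ) y₁ = y₁ := hsy
  -- ### the HALF point (#S1′) and its exponent-`0` display at `(A, B)`
  obtain ⟨T₃, -, Y₁, Y', -, -, -, hdisp⟩ := exists_halfPoint_of_named_of_fixing hω h2 ι hD Dt hdeg hp hp7 h3 κ hκG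
    hκ hvBc hvB hvB3 hψB hρ hlawB (emb (9 * p)) (hembK _) ιe hιe N₀ hN₀ hc₃ hcp H hH sH H' hH' y₁ hy₁ hsy'
  obtain ⟨CB, hCB⟩ := hB
  obtain ⟨P, Y, hP, hgen, hid, -⟩ := hdisp A B CB hCB hA qB qA hqB hqA
  -- ### `rank_ℤ B(K) = 2` and `qB·qA ≠ 0` from #19 (1); then the `2`-primitive descent
  obtain ⟨qB', qA', hqB', hqA', hne, hrank, -⟩ := (hD p hp (Or.inr hp7) h3 K ω hω h2).1 A B ⟨CB, hCB⟩ hA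
  have eB : qB = qB' := by exact_mod_cast hqB.symm.trans hqB'
  have eA : qA = qA' := by exact_mod_cast hqA.symm.trans hqA'
  have hq : qB * qA ≠ 0 := by rw [eB, eA]; exact hne
  have h0 := SylvesterTwoNonneg.le_padicValRat_two_of_model hω h2 hp hp2 B CB hCB hrank P hP hgen Y hq hid
  exact_mod_cast h0

/-- **`stub_thmC` MODULO {`Dt` of degree 6, #19, TOWER FIXING at `n = 1`}** — THEOREM C (★) in the skeleton's
typing `PublishedFactsTwoPlus → SylvesterTwoNonneg.HSYPointTwoDivisibleSevenModNine` (VARIANT M l.187–204,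
VERBATIM after the displayed binders): the display conjunct of `PublishedFactsTwoPlus` and the integrality above
feed two's `hsyPointTwoDivisibleSevenModNine_of_heightDisplay_of_twoIntegral`.  CONDITIONAL; item 19802 stays
open on the ledger; BSD is not proved by any of this. [cite: HuShuYin2019, display (bsd) p. 12, §3 p. 8]
[cite: GrossLMS1991, §3–§4] -/
theorem thmC_of_named_of_fixing
    (Dt : ModularParametrizationData (⟨0, 0, 1, 0, -1⟩ : WeierstrassCurve ℚ) 243) (hdeg : Dt.deg = 6)
    (hD : shaAnPair_mul_height_eq_two_zpow_mul_height_named)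
    (hTF₁ : ∀ (p : ℕ), p.Prime → p % 9 = 7 → ∀ (K : Type) [Field K] [NumberField K] (ω : K), ω ^ 2 + ω + 1 = 0 →
      Module.finrank ℚ K = 2 → ∀ (ι : K →+* ℂ) (c₃ cp : ringClassField K ι (9 * p)), c₃ ^ 3 = 3 →
      cp ^ 3 = (p : ringClassField K ι (9 * p)) →
      ∀ (y₁ : ((⟨0, 0, 1, 0, -1⟩ : WeierstrassCurve ℚ).baseChange (ringClassField K ι (9 * p))).toAffine.Point),
        Affine.Point.map (W' := (⟨0, 0, 1, 0, -1⟩ : WeierstrassCurve ℚ)) (ringClassField K ι (9 * p)).subtype.toRatAlgHom y₁ =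
          Dt.φ (heegnerTau (81 * ((p : ℤ) ^ 2 + 4 * p + 16), -(9 * (4 * (p : ℤ) ^ 2 + 17 * p + 72)), 4 * (p : ℤ) ^ 2 + 18 * p + 81)) →
      ∃ s : ringClassField K ι (9 * p) ≃ₐ[K] ringClassField K ι (9 * p), s ≠ 1 ∧ s * s = 1 ∧ s c₃ = c₃ ∧ s cp = cp ∧
        pointGalHom (⟨0, 0, 1, 0, -1⟩ : WeierstrassCurve ℚ) (ringClassField K ι (9 * p)) (s.restrictScalars ℚ) y₁ = y₁) :
    PublishedFactsTwoPlus → SylvesterTwoNonneg.HSYPointTwoDivisibleSevenModNine :=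
  fun hFP ↦ SylvesterTwoNonneg.hsyPointTwoDivisibleSevenModNine_of_heightDisplay_of_twoIntegral hFP.2
    (pairProductTwoIntegralSevenModNine_of_named_of_fixing Dt hdeg hD hTF₁)

/-- **Item 19802's ROUTE DECL `Theses.SylvesterTwoHeegnerIndex.HSYPointTwoDivisibleSevenModNine` MODULO
{`Dt` of degree 6, #19, Hu–Shu–Yin's display (bsd), TOWER FIXING at `n = 1`}** (the route decl is the
Theorems-side (★) by `Iff.rfl`).  CONDITIONAL; the item stays open; BSD is not proved by any of this.
[cite: HuShuYin2019, display (bsd) p. 12, §3 p. 8] [cite: GrossLMS1991, §3–§4] -/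
theorem theses_hsyPointTwoDivisibleSevenModNine_of_named_of_fixing
    (Dt : ModularParametrizationData (⟨0, 0, 1, 0, -1⟩ : WeierstrassCurve ℚ) 243) (hdeg : Dt.deg = 6)
    (hD : shaAnPair_mul_height_eq_two_zpow_mul_height_named) (hH : shaAnPair_mul_height_eq_two_zpow_mul_height)
    (hTF₁ : ∀ (p : ℕ), p.Prime → p % 9 = 7 → ∀ (K : Type) [Field K] [NumberField K] (ω : K), ω ^ 2 + ω + 1 = 0 →
      Module.finrank ℚ K = 2 → ∀ (ι : K →+* ℂ) (c₃ cp : ringClassField K ι (9 * p)), c₃ ^ 3 = 3 →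
      cp ^ 3 = (p : ringClassField K ι (9 * p)) →
      ∀ (y₁ : ((⟨0, 0, 1, 0, -1⟩ : WeierstrassCurve ℚ).baseChange (ringClassField K ι (9 * p))).toAffine.Point),
        Affine.Point.map (W' := (⟨0, 0, 1, 0, -1⟩ : WeierstrassCurve ℚ)) (ringClassField K ι (9 * p)).subtype.toRatAlgHom y₁ =
          Dt.φ (heegnerTau (81 * ((p : ℤ) ^ 2 + 4 * p + 16), -(9 * (4 * (p : ℤ) ^ 2 + 17 * p + 72)), 4 * (p : ℤ) ^ 2 + 18 * p + 81)) →
      ∃ s : ringClassField K ι (9 * p) ≃ₐ[K] ringClassField K ι (9 * p), s ≠ 1 ∧ s * s = 1 ∧ s c₃ = c₃ ∧ s cp = cp ∧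
        pointGalHom (⟨0, 0, 1, 0, -1⟩ : WeierstrassCurve ℚ) (ringClassField K ι (9 * p)) (s.restrictScalars ℚ) y₁ = y₁) :
    Summit.BirchSwinnertonDyer.BirchSwinnertonDyer.Theses.SylvesterTwoHeegnerIndex.HSYPointTwoDivisibleSevenModNine :=
  SylvesterTwoNonneg.hsyPointTwoDivisibleSevenModNine_of_heightDisplay_of_twoIntegral hH
    (pairProductTwoIntegralSevenModNine_of_named_of_fixing Dt hdeg hD hTF₁)

end Summit.BirchSwinnertonDyer.BirchSwinnertonDyer.Theorems.SylvesterTwoCMHalf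

end
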